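import Summits.CriticalPhenomena.CardyFormulaZ2.Theorems.CardyUniqueLimitCardyRigidityKernelODEMaxPrinciple

/-!
# Kernels with the asymptotic mean-value property are classical solutions (line `crossing-martingale`, crux `CardyRigidity`)

Pure real analysis on top of the maximum principle `KernelODE.sub_le_max_of_mvp`
(`…KernelODEMaxPrinciple`); third `KernelODE` file of the unified analysis stub `stub_kernelAffineCardy`
(crux `CardyRigidity`, stmt-CriticalPhenomena-0746; lead `prover-line-stmt-CriticalPhenomena-0746-0`).
Theorems only (no definitions).

THEOREM (`KernelODE.classical_of_mvp`): let `f` be continuous on `[p, q]`, `p < q`, with the asymptotic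
mean-value property at every interior point (the hypothesis of `sub_le_max_of_mvp`, verbatim: along
`n → ∞`, probability measures `ν_n` carried by `[-r_n, r_n]`, `r_n → 0`, with `f η = ∫ f (η + x) dν_n`
exactly and `∫ x dν_n = α η / n² + o(n⁻²)`, `∫ x² dν_n = β η / n² + o(n⁻²)`), with `α, β` continuous on
`[p, q]` and `β > 0`.  Then `f` is `C²` on `(p, q)` and solves the generator equation
`(β/2) f'' + α f' = 0` there (derivatives `f₁`, `f₂` are produced explicitly, both continuous on `ℝ`).

Proof: the two-point boundary-value problem for the generator equation is solved explicitly —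
`u = f p + C · G` with `G η = ∫_p^η E`, `E = exp(-∫_p 2α/β)` (coefficients clamped to `[p, q]` so that
everything is globally differentiable), `C = (f q - f p)/G q`, `G q > 0` — and the maximum principle
applied to `(f, u)` and to `(-f, -u)` gives `f = u` on `[p, q]`; the derivatives of `u` are then
derivatives of `f` in the open interval.  This is the step "`f ∈ C²` and the generator equation along
the mark-shape family" of the regularity bootstrap for a merely continuous crossing-martingale kernel.
-/

noncomputable section

open MeasureTheory Filter Set Topology
open scoped BigOperators

namespace Summit.CriticalPhenomena.CardyFormulaZ2.Cruxes.CardyRigidity.CrossingMartingale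

namespace KernelODE

/-! ### The clamped coefficient and the explicit two-point solution -/

/-- The clamped coefficient `γ = 2α/β ∘ clamp_{[p,q]}` is continuous on `ℝ` and agrees with `2α/β`
on `[p, q]`. [folklore] -/
theorem exists_continuous_gamma {α β : ℝ → ℝ} {p q : ℝ} (hpq : p ≤ q)
    (hα : ContinuousOn α (Icc p q)) (hβ : ContinuousOn β (Icc p q)) (hβ0 : ∀ η ∈ Icc p q, 0 < β η) :
    ∃ γ : ℝ → ℝ, Continuous γ ∧ ∀ η ∈ Icc p q, γ η = 2 * α η / β η := by
  have hcl : Continuous fun x : ℝ ↦ max p (min q x) :=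
    continuous_const.max (continuous_const.min continuous_id)
  have hmem : ∀ x : ℝ, max p (min q x) ∈ Icc p q := fun x ↦
    ⟨le_max_left _ _, max_le hpq (min_le_left _ _)⟩
  have hαc : Continuous fun x ↦ α (max p (min q x)) := hα.comp_continuous hcl hmem
  have hβc : Continuous fun x ↦ β (max p (min q x)) := hβ.comp_continuous hcl hmem
  refine ⟨fun x ↦ 2 * α (max p (min q x)) / β (max p (min q x)),
    (continuous_const.mul hαc).div hβc fun x ↦ (hβ0 _ (hmem x)).ne', fun η hη ↦ ?_⟩
  simp only [min_eq_right hη.2, max_eq_right hη.1]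

/-- **The two-point boundary-value problem for the generator equation.**  For `γ` continuous there is
`u`, differentiable twice on `ℝ` with continuous `u' = u₁`, `u₁' = u₂ = -γ u₁`, and prescribed values
`u p = A`, `u q = B` (`p < q`): `u = A + C ∫_p E`, `E = exp (-∫_p γ)`. [folklore] -/
theorem exists_bvp_solution {γ : ℝ → ℝ} (hγ : Continuous γ) {p q : ℝ} (hpq : p < q) (A B : ℝ) :
    ∃ u u₁ u₂ : ℝ → ℝ, (∀ x, HasDerivAt u (u₁ x) x) ∧ (∀ x, HasDerivAt u₁ (u₂ x) x) ∧
      Continuous u₁ ∧ Continuous u₂ ∧ (∀ x, u₂ x = -γ x * u₁ x) ∧ u p = A ∧ u q = B := by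
  -- the integrating factor `E = exp (-∫_p γ)` and its primitive `G`
  set E : ℝ → ℝ := fun x ↦ Real.exp (-∫ s in p..x, γ s) with hE
  have hEd : ∀ x, HasDerivAt E (E x * -γ x) x := by
    intro x
    have h1 : HasDerivAt (fun u ↦ ∫ s in p..u, γ s) (γ x) x :=
      (hγ.integral_hasStrictDerivAt p x).hasDerivAt
    have h2 : HasDerivAt (fun u ↦ Real.exp (-∫ s in p..u, γ s))
        (Real.exp (-∫ s in p..x, γ s) * -γ x) x := h1.neg.exp
    exact h2
  have hEc : Continuous E := continuous_iff_continuousAt.2 fun x ↦ (hEd x).continuousAt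
  have hEpos : ∀ x, 0 < E x := fun x ↦ Real.exp_pos _
  set G : ℝ → ℝ := fun x ↦ ∫ s in p..x, E s with hG
  have hGd : ∀ x, HasDerivAt G (E x) x := fun x ↦ (hEc.integral_hasStrictDerivAt p x).hasDerivAt
  have hGp : G p = 0 := intervalIntegral.integral_same
  have hGq : 0 < G q :=
    intervalIntegral.intervalIntegral_pos_of_pos (hEc.intervalIntegrable _ _) hEpos hpq
  set C : ℝ := (B - A) / G q with hC
  refine ⟨fun x ↦ A + C * G x, fun x ↦ C * E x, fun x ↦ C * (E x * -γ x),
    fun x ↦ ((hGd x).const_mul C).const_add A, fun x ↦ (hEd x).const_mul C,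
    continuous_const.mul hEc, continuous_const.mul (hEc.mul hγ.neg), fun x ↦ by ring, ?_, ?_⟩
  · simp only [hGp, mul_zero, add_zero]
  · have hGq0 : G q ≠ 0 := hGq.ne'
    simp only [hC]
    field_simp
    ring

/-! ### The identification `f = u` and the classical regularity of `f` -/

/-- **Kernels with the asymptotic mean-value property are classical solutions.**  Let `f` be
continuous on `[p, q]` (`p < q`) with the asymptotic mean-value property at every interior point
(probability measures `ν_n` carried by `[-r_n, r_n]`, `r_n → 0`, `f η = ∫ f (η + x) dν_n` exactly,
`∫ x dν_n = α η/n² + o(n⁻²)`, `∫ x² dν_n = β η/n² + o(n⁻²)`), `α, β` continuous on `[p, q]`, `β > 0`.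
Then `f` is `C²` on `(p, q)` with `(β/2) f'' + α f' = 0`: there are `f₁, f₂`, continuous on `ℝ`, with
`f' = f₁`, `f₁' = f₂` on `(p, q)`, solving the generator equation.  Proof: maximum principle
(`sub_le_max_of_mvp`) for `(f, u)` and `(-f, -u)` against the two-point solution `u` with the boundary
values of `f`. [folklore] -/
theorem classical_of_mvp {f α β : ℝ → ℝ} {p q : ℝ} (hpq : p < q)
    (hf : ContinuousOn f (Icc p q))
    (hmvp : ∀ η ∈ Ioo p q, ∃ r e : ℕ → ℝ, Tendsto r atTop (𝓝 0) ∧ Tendsto e atTop (𝓝 0) ∧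
      ∀ᶠ n : ℕ in atTop, ∃ ν : Measure ℝ, IsProbabilityMeasure ν ∧ ν (Icc (-(r n)) (r n))ᶜ = 0 ∧
        f η = ∫ x, f (η + x) ∂ν ∧
        |∫ x, x ∂ν - α η / (n : ℝ) ^ 2| ≤ e n / (n : ℝ) ^ 2 ∧
        |∫ x, x ^ 2 ∂ν - β η / (n : ℝ) ^ 2| ≤ e n / (n : ℝ) ^ 2)
    (hα : ContinuousOn α (Icc p q)) (hβ : ContinuousOn β (Icc p q))
    (hβ0 : ∀ η ∈ Icc p q, 0 < β η) :
    ∃ f₁ f₂ : ℝ → ℝ, (∀ η ∈ Ioo p q, HasDerivAt f (f₁ η) η) ∧ (∀ η ∈ Ioo p q, HasDerivAt f₁ (f₂ η) η) ∧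
      Continuous f₁ ∧ Continuous f₂ ∧ ∀ η ∈ Ioo p q, β η / 2 * f₂ η + α η * f₁ η = 0 := by
  obtain ⟨γ, hγ, hγeq⟩ := exists_continuous_gamma hpq.le hα hβ hβ0
  obtain ⟨u, u₁, u₂, hud, hu₁d, hu₁c, hu₂c, hu₂eq, hup, huq⟩ :=
    exists_bvp_solution hγ hpq (f p) (f q)
  have huc : Continuous u := continuous_iff_continuousAt.2 fun x ↦ (hud x).continuousAt
  -- the generator equation for `u` inside `(p, q)`
  have hode : ∀ η ∈ Ioo p q, β η / 2 * u₂ η + α η * u₁ η = 0 := by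
    intro η hη
    have hηI : η ∈ Icc p q := Ioo_subset_Icc_self hη
    have hβne : β η ≠ 0 := (hβ0 η hηI).ne'
    rw [hu₂eq η, hγeq η hηI]
    field_simp
    ring
  -- maximum principle for `(f, u)`: `f ≤ u`
  have hle : ∀ η ∈ Icc p q, f η - u η ≤ 0 := by
    intro η hη
    have h := sub_le_max_of_mvp hpq.le hf huc.continuousOn hmvp hα hβ hβ0
      (fun x _ ↦ hud x) (fun x _ ↦ hu₁d x) hu₂c.continuousOn hode η hη
    rwa [hup, huq, sub_self, sub_self, max_self] at h
  -- maximum principle for `(-f, -u)`: `u ≤ f`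
  have hge : ∀ η ∈ Icc p q, u η - f η ≤ 0 := by
    intro η hη
    have hmvp' : ∀ η ∈ Ioo p q, ∃ r e : ℕ → ℝ, Tendsto r atTop (𝓝 0) ∧ Tendsto e atTop (𝓝 0) ∧
        ∀ᶠ n : ℕ in atTop, ∃ ν : Measure ℝ, IsProbabilityMeasure ν ∧ ν (Icc (-(r n)) (r n))ᶜ = 0 ∧
          (fun x ↦ -f x) η = ∫ x, (fun x ↦ -f x) (η + x) ∂ν ∧
          |∫ x, x ∂ν - α η / (n : ℝ) ^ 2| ≤ e n / (n : ℝ) ^ 2 ∧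
          |∫ x, x ^ 2 ∂ν - β η / (n : ℝ) ^ 2| ≤ e n / (n : ℝ) ^ 2 := by
      intro η' hη'
      obtain ⟨r, e, hr, he, hev⟩ := hmvp η' hη'
      refine ⟨r, e, hr, he, hev.mono ?_⟩
      rintro n ⟨ν, hν, hsupp, hmv, hm1, hm2⟩
      refine ⟨ν, hν, hsupp, ?_, hm1, hm2⟩
      simp only [integral_neg, hmv]
    have hode' : ∀ η ∈ Ioo p q, β η / 2 * (fun x ↦ -u₂ x) η + α η * (fun x ↦ -u₁ x) η = 0 := by
      intro η' hη'
      have := hode η' hη'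
      simp only [mul_neg]
      linarith
    have h := sub_le_max_of_mvp (f := fun x ↦ -f x) (u := fun x ↦ -u x) (u₁ := fun x ↦ -u₁ x)
      (u₂ := fun x ↦ -u₂ x) hpq.le hf.neg huc.neg.continuousOn hmvp' hα hβ hβ0
      (fun x _ ↦ (hud x).neg) (fun x _ ↦ (hu₁d x).neg) hu₂c.neg.continuousOn hode' η hη
    simp only [hup, huq, sub_neg_eq_add, neg_add_cancel, max_self] at h
    linarith
  have hfu : EqOn f u (Icc p q) := fun η hη ↦ by linarith [hle η hη, hge η hη]
  -- transfer the derivatives of `u` to `f` inside `(p, q)`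
  refine ⟨u₁, u₂, fun η hη ↦ ?_, fun η _ ↦ hu₁d η, hu₁c, hu₂c, hode⟩
  have hev : f =ᶠ[𝓝 η] u :=
    Filter.eventuallyEq_of_mem (Ioo_mem_nhds hη.1 hη.2) fun x hx ↦ hfu (Ioo_subset_Icc_self hx)
  exact (hud η).congr_of_eventuallyEq hev

/-- **Registered form** (glue sub-goal `kernelODE_classical_of_mvp` of stmt-CriticalPhenomena-0746): a
continuous kernel with the asymptotic mean-value property relative to continuous coefficients `α`,
`β > 0` is a classical `C²` solution of the generator equation `(β/2) f'' + α f' = 0` in the open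
interval. [folklore] -/
theorem kernelODE_classical_of_mvp : ∀ {f α β : ℝ → ℝ} {p q : ℝ}, p < q → ContinuousOn f (Set.Icc p q) → (∀ η ∈ Set.Ioo p q, ∃ r e : ℕ → ℝ, Filter.Tendsto r Filter.atTop (nhds 0) ∧ Filter.Tendsto e Filter.atTop (nhds 0) ∧ ∀ᶠ n : ℕ in Filter.atTop, ∃ ν : MeasureTheory.Measure ℝ, MeasureTheory.IsProbabilityMeasure ν ∧ ν (Set.Icc (-(r n)) (r n))ᶜ = 0 ∧ f η = ∫ x, f (η + x) ∂ν ∧ |∫ x, x ∂ν - α η / (n : ℝ) ^ 2| ≤ e n / (n : ℝ) ^ 2 ∧ |∫ x, x ^ 2 ∂ν - β η / (n : ℝ) ^ 2| ≤ e n / (n : ℝ) ^ 2) → ContinuousOn α (Set.Icc p q) → ContinuousOn β (Set.Icc p q) → (∀ η ∈ Set.Icc p q, 0 < β η) → ∃ f₁ f₂ : ℝ → ℝ, (∀ η ∈ Set.Ioo p q, HasDerivAt f (f₁ η) η) ∧ (∀ η ∈ Set.Ioo p q, HasDerivAt f₁ (f₂ η) η) ∧ Continuous f₁ ∧ Continuous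 f₂ ∧ ∀ η ∈ Set.Ioo p q, β η / 2 * f₂ η + α η * f₁ η = 0 :=
  fun hpq hf hmvp hα hβ hβ0 ↦ classical_of_mvp hpq hf hmvp hα hβ hβ0

end KernelODE

end Summit.CriticalPhenomena.CardyFormulaZ2.Cruxes.CardyRigidity.CrossingMartingale

end
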